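import Literature.NumberTheory.EllipticCurves.ZpExtensionEisensteinReadoutOrdinaryLocalKummerStrictProofs
import Literature.NumberTheory.EllipticCurves.ZpExtensionEisensteinOrdinaryCoboundaryShiftMultiplicativeThreeProofs
import HarnessLib

/-!
# The Selmer readout at a place `v ∣ 3` of MULTIPLICATIVE reduction, from the local inclusion `localKerOver ≤ strictKer`
# (theorems only — no definition, no named fact, no instance, no `sorry`)

Topic `NumberTheory/EllipticCurves` (LEAD `bsd-wall-utd-p1`, crux r205 stmt-BirchSwinnertonDyer-24737 `TwinAlgMuZeroAtThree`,
line `beta-road`, stub `stub_howardOutputsOfFamily`, E2 assembly at `v ∣ 3`).  x9's frame-restricted readout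
`ZpExtensionEisensteinReadoutOrdinaryLocalKummerStrictProofs.exists_quotient_cocycle_principal_of_eisensteinTowerReadout_mem_selmerInfty_of_localKerOver_le`
(principal parts of the readout classes in the Selmer group over `K_∞`, given the local inclusion KS(v): `localKerOver ≤ strictKer` for
Greenberg's `C_v`) uses good reduction only through the coboundary shift `exists_shift_coboundary_mod_kernelOfReduction`; at places of
MULTIPLICATIVE reduction above `3` that is `ZpExtensionEisensteinOrdinaryCoboundaryShiftMultiplicativeThreeProofs`.  This file: the same
statement and proof at `p = 3` with `(hgood, hord')` replaced by `hmult`; the hypothesis `hKS` stays (for the twin it is to be supplied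
from the Tate parametrisation: `Greenberg1999.KummerImageMultiplicativeTateProofs`, X2 `tateDatum_kummer_all` /
`localKerOver_le_strictKer_of_kummer_all`).  The other two theorems of x9's file are reduction-type-free and imported.
BSD is not proved by any of this.

References: [Howard2004HeegnerKolyvagin] Lemma 2.2.7, Prop. 2.2.8, Thm. 2.2.10; [GreenbergLNM1716] §2 Props. 2.2, 2.4, §4; [Greenberg1989] §1.
-/

set_option autoImplicit false

noncomputable section

open scoped Classical ContRepresentation

open NumberField IsDedekindDomain Field
open Literature.NumberTheory.EllipticCurves Literature.NumberTheory.GaloisRepresentations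
open Literature.NumberTheory.GaloisRepresentations.galoisCohomology
open Literature.NumberTheory.GaloisCohomology.Howard2004
open Literature.NumberTheory.EllipticCurves.GreenbergSelmer
open IwasawaAlgebra IwasawaAlgebra.EisensteinCoeff

namespace WeierstrassCurve

open Literature.NumberTheory.EllipticCurves.ZpExtension (EisensteinLevel)

variable {K : Type} [Field K] [NumberField K] (W : WeierstrassCurve ℚ) [W.IsElliptic]
  (κ : ZpExtension K 3) {m : ℕ} (hm : 1 ≤ m)

variable (π : IwasawaAlgebra 3 ⧸ Ideal.span {(PowerSeries.X ^ m + PowerSeries.C ((3 : ℕ) : ℤ_[3]) : IwasawaAlgebra 3)})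
  (e : ℕ → ℕ)
  (hkill : letI := IwasawaAlgebra.isLocalRing_quotient_X_pow_add_C 3 hm
    ∀ k, ∀ r ∈ IsLocalRing.maximalIdeal
      (IwasawaAlgebra 3 ⧸ Ideal.span {(PowerSeries.X ^ m + PowerSeries.C ((3 : ℕ) : ℤ_[3]) : IwasawaAlgebra 3)}) ^ e k,
      ∀ x : EisensteinLevel 3 m (fun j ↦ geomTorsion (W.baseChange K) (((3 : ℕ) : ℤ) ^ j)) (k + 1), r • x = 0)
  (hker : letI := IwasawaAlgebra.isLocalRing_quotient_X_pow_add_C 3 hm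
    ∀ k, LinearMap.ker ((W.eisensteinTower (κ.unitTwist (-1)) hm).red k) =
      (IsLocalRing.maximalIdeal
        (IwasawaAlgebra 3 ⧸ Ideal.span {(PowerSeries.X ^ m + PowerSeries.C ((3 : ℕ) : ℤ_[3]) : IwasawaAlgebra 3)}) ^ e k) •
        (⊤ : Submodule (IwasawaAlgebra 3 ⧸ Ideal.span {(PowerSeries.X ^ m + PowerSeries.C ((3 : ℕ) : ℤ_[3]) : IwasawaAlgebra 3)})
          (EisensteinLevel 3 m (fun j ↦ geomTorsion (W.baseChange K) (((3 : ℕ) : ℤ) ^ j)) (k + 1 + 1))))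
  (hπ : letI := IwasawaAlgebra.isLocalRing_quotient_X_pow_add_C 3 hm
    π ∈ IsLocalRing.maximalIdeal
      (IwasawaAlgebra 3 ⧸ Ideal.span {(PowerSeries.X ^ m + PowerSeries.C ((3 : ℕ) : ℤ_[3]) : IwasawaAlgebra 3)}))
  (he : ∀ k, e k ≤ e (k + 1))
  (hπX : π = Ideal.Quotient.mk _ PowerSeries.X) (hek : ∀ k, e (k + 1) - e k = m)

/-! ## §1 (B4) at `v ∣ p` from `strictKer ≤ localKerOver` -/

set_option maxHeartbeats 1600000 in -- statement-size unification of the letter shapes (as the original)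
include hπX hek in
/-- **hS′ at `v ∣ p` over the local inclusion `localKerOver ≤ strictKer`** — verbatim
`exists_quotient_cocycle_principal_of_eisensteinTowerReadout_mem_selmerInfty` (x10b-p1-w6 g4, p678180) with the binders
`(hord) (hram) (hCG)` replaced by `hKS` and the one leaf call replaced by `exists_grMk_eq_coboundary_of_localKerOver_le_strictKer`:
there is `d` such that for every level `k` and class `c` whose readout lies in `Sel_{p^∞}(E/K_∞)`, the image of
`incLocIter … d (loc_v c)` in `H¹(K_v, T^{(k+d)}/Fil_v)` has a cocycle which is an honest coboundary on the elements of `Γ_{K_v}`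
restricting into `Gal(K̄/K_∞)`. [cite: Howard2004HeegnerKolyvagin, Lemma 2.2.7 / Prop. 2.2.8 and proof of Thm. 2.2.10 (arXiv p. 17 L41–53)]
[cite: GreenbergLNM1716, §2 Prop. 2.2, Prop. 2.4 (pp. 73–80) and §4 pp. 107, 124] -/
theorem exists_quotient_cocycle_principal_of_eisensteinTowerReadout_mem_selmerInfty_of_localKerOver_le_of_hasMultiplicativeReductionAt_three {γ : absoluteGaloisGroup K}
    (hγ : κ.IsTopGenerator γ) (v : HeightOneSpectrum (𝓞 K)) (hpv : ((3 : ℕ) : 𝓞 K) ∈ v.asIdeal)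
    (hmult : (W.baseChange K).HasMultiplicativeReductionAt v)
    (hKS : (W.baseChange K).localKerOver 3 κ.kerSubgroup (v.adicCompletion K) ≤
      ((W.baseChange K).kernelOfReductionLocalDatum 3 v).strictKer κ.kerSubgroup) :
    letI := IwasawaAlgebra.isLocalRing_quotient_X_pow_add_C 3 hm
    ∃ d : ℕ, ∀ (k : ℕ) (c : galoisCohomology
        ((κ.unitTwist (-1)).eisensteinTwist ((W.baseChange K).torsionGaloisModule (((3 : ℕ) : ℤ) ^ (k + 1))) hm (k + 1)) 1),
      W.eisensteinTowerReadout κ hm π e hkill hker hπ he hπX hek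
          (AddCommGroup.DirectLimit.of _ _ k c :
            AdicTower.H1A (W.eisensteinTower (κ.unitTwist (-1)) hm) π e hkill hker hπ he) ∈
        (W.baseChange K).selmerInfty κ →
      ∃ φq : contOneCocycles ((GaloisRep.toLocal v ((κ.unitTwist (-1)).eisensteinTwist
          ((W.baseChange K).torsionGaloisModule (((3 : ℕ) : ℤ) ^ (k + d + 1))) hm (k + d + 1))).quotient
          (((W.baseChange K).ordinaryFiltrationAt v (fun i ↦ (W.baseChange K).torsionGaloisModuleReduce 3 i)
            (fun _ _ ↦ rfl)).twistedFil (k + d + 1))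
          (((W.baseChange K).ordinaryFiltrationAt v (fun i ↦ (W.baseChange K).torsionGaloisModuleReduce 3 i)
            (fun _ _ ↦ rfl)).twistedFil_le_comap (κ := κ.unitTwist (-1)) hm (k + d + 1))).toTopRep,
        oneCocycleClass _ φq =
          DiscreteGaloisModule.quotientMap (GaloisRep.toLocal v ((κ.unitTwist (-1)).eisensteinTwist
              ((W.baseChange K).torsionGaloisModule (((3 : ℕ) : ℤ) ^ (k + d + 1))) hm (k + d + 1)))
            (((W.baseChange K).ordinaryFiltrationAt v (fun i ↦ (W.baseChange K).torsionGaloisModuleReduce 3 i)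
              (fun _ _ ↦ rfl)).twistedFil (k + d + 1))
            (((W.baseChange K).ordinaryFiltrationAt v (fun i ↦ (W.baseChange K).torsionGaloisModuleReduce 3 i)
              (fun _ _ ↦ rfl)).twistedFil_le_comap (κ := κ.unitTwist (-1)) hm (k + d + 1)) 1
            (AdicTower.incLocIter (W.eisensteinTower (κ.unitTwist (-1)) hm) π e hkill hker hπ he k (Sum.inr v) d
              (galoisCohomology.localization
                ((κ.unitTwist (-1)).eisensteinTwist ((W.baseChange K).torsionGaloisModule (((3 : ℕ) : ℤ) ^ (k + 1))) hm (k + 1))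
                (Sum.inr v) 1 c)) ∧
        ∃ q₀ : Twisted 3 m (k + d + 1) (geomTorsion (W.baseChange K) (((3 : ℕ) : ℤ) ^ (k + d + 1))) ⧸
            ((W.baseChange K).ordinaryFiltrationAt v (fun i ↦ (W.baseChange K).torsionGaloisModuleReduce 3 i)
              (fun _ _ ↦ rfl)).twistedFil (k + d + 1),
          ∀ σ : absoluteGaloisGroup (v.adicCompletion K), absGaloisRestrict K (v.adicCompletion K) σ ∈ κ.kerSubgroup →
            φq.1 σ = (GaloisRep.toLocal v ((κ.unitTwist (-1)).eisensteinTwist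
                ((W.baseChange K).torsionGaloisModule (((3 : ℕ) : ℤ) ^ (k + d + 1))) hm (k + d + 1))).quotient
                (((W.baseChange K).ordinaryFiltrationAt v (fun i ↦ (W.baseChange K).torsionGaloisModuleReduce 3 i)
                  (fun _ _ ↦ rfl)).twistedFil (k + d + 1))
                (((W.baseChange K).ordinaryFiltrationAt v (fun i ↦ (W.baseChange K).torsionGaloisModuleReduce 3 i)
                  (fun _ _ ↦ rfl)).twistedFil_le_comap (κ := κ.unitTwist (-1)) hm (k + d + 1)) σ q₀ - q₀ := by
  letI := IwasawaAlgebra.isLocalRing_quotient_X_pow_add_C 3 hm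
  obtain ⟨d, hd⟩ := (W.baseChange K).exists_shift_coboundary_mod_kernelOfReduction_of_hasMultiplicativeReductionAt_three κ v hpv hmult
  refine ⟨d, fun k c hc ↦ ?_⟩
  have hsurj := oneCocycleClass_surjective
    ((κ.unitTwist (-1)).eisensteinTwist ((W.baseChange K).torsionGaloisModule (((3 : ℕ) : ℤ) ^ (k + 1))) hm (k + 1)).toTopRep c
  rcases hsurj with ⟨ξ, hξ⟩
  rw [← hξ] at hc
  have hlast : m - 1 < m := Nat.sub_lt (lt_of_lt_of_le zero_lt_one hm) zero_lt_one
  have hcoord := (κ.unitTwist (-1)).exists_coordCocycles hm (k + 1)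
    ((κ.unitTwist (-1)).eisensteinTwistChar hm (k + 1)) ((W.baseChange K).torsionGaloisModule (((3 : ℕ) : ℤ) ^ (k + 1)))
    (fun σ y ↦ (κ.unitTwist (-1)).eisensteinTwist_torsionGaloisModule_apply hm (k + 1) (W.baseChange K) _ σ y) κ
    (fun b ↦ (W.baseChange K).geomTorsion_pow_nsmul_eq_zero 3 (k + 1) b)
    (fun _ hσ ↦ κ.eisensteinTwistChar_unitTwist_eq_one_of_mem_kerSubgroup hm (k + 1) (-1) hσ) ξ
  rcases hcoord with ⟨φ, hφ⟩
  -- (1) the readout of `[ξ]` is `(-1)^k • ι_* [φ_{m-1}]`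
  have hread : W.eisensteinTowerReadout κ hm π e hkill hker hπ he hπX hek
      (AddCommGroup.DirectLimit.of _ _ k (oneCocycleClass ((κ.unitTwist (-1)).eisensteinTwist
        ((W.baseChange K).torsionGaloisModule (((3 : ℕ) : ℤ) ^ (k + 1))) hm (k + 1)).toTopRep ξ :
          galoisCohomology ((κ.unitTwist (-1)).eisensteinTwist
            ((W.baseChange K).torsionGaloisModule (((3 : ℕ) : ℤ) ^ (k + 1))) hm (k + 1)) 1) :
        AdicTower.H1A (W.eisensteinTower (κ.unitTwist (-1)) hm) π e hkill hker hπ he) =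
      ((-1 : ℤ) ^ k) • resH1Hom (ContinuousMonoidHom.id κ.kerSubgroup)
        (AddSubgroup.inclusion (AcSigned.geomTorsion_zpow_le_geomPrimaryTorsion (W.baseChange K) 3 (k + 1)))
        (fun _ _ ↦ rfl) (oneCocycleClass _ (φ ⟨m - 1, hlast⟩)) := by
    rw [WeierstrassCurve.eisensteinTowerReadout, ZpExtension.eisensteinTowerReadout_of,
      ZpExtension.eisensteinTowerLevelMap_apply,
      (κ.unitTwist (-1)).eisensteinTwistLevelReadout_oneCocycleClass hm (k + 1) _ _ _ κ _ _ ξ φ hφ]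
  -- (2) every coordinate class lies in `ι_*⁻¹ Sel_∞` (shift relations; `Sel_∞` is `conj_γ`-stable)
  have h𝒮M : ∀ s ∈ ((W.baseChange K).selmerInfty κ).comap (resH1Hom (ContinuousMonoidHom.id κ.kerSubgroup)
      (AddSubgroup.inclusion (AcSigned.geomTorsion_zpow_le_geomPrimaryTorsion (W.baseChange K) 3 (k + 1))) (fun _ _ ↦ rfl)),
      Literature.NumberTheory.EllipticCurves.conjH1 κ.kerSubgroup (geomTorsion (W.baseChange K) (((3 : ℕ) : ℤ) ^ (k + 1))) γ s ∈
        ((W.baseChange K).selmerInfty κ).comap (resH1Hom (ContinuousMonoidHom.id κ.kerSubgroup)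
          (AddSubgroup.inclusion (AcSigned.geomTorsion_zpow_le_geomPrimaryTorsion (W.baseChange K) 3 (k + 1))) (fun _ _ ↦ rfl)) := by
    intro s hs
    rw [AddSubgroup.mem_comap] at hs ⊢
    rw [W.resH1Hom_inclusion_conjH1 κ γ (k + 1)]
    exact (W.baseChange K).map_conjH1_selmerGroupOver_le_holds 3 κ.kerSubgroup γ ⟨_, hs, rfl⟩
  have hlastmem : oneCocycleClass _ (φ ⟨m - 1, hlast⟩) ∈ ((W.baseChange K).selmerInfty κ).comap
      (resH1Hom (ContinuousMonoidHom.id κ.kerSubgroup)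
        (AddSubgroup.inclusion (AcSigned.geomTorsion_zpow_le_geomPrimaryTorsion (W.baseChange K) 3 (k + 1))) (fun _ _ ↦ rfl)) := by
    rw [AddSubgroup.mem_comap]
    have h2 := ((W.baseChange K).selmerInfty κ).zsmul_mem hc ((-1 : ℤ) ^ k)
    rw [hread, smul_smul, ← mul_pow, neg_mul_neg, one_mul, one_pow, one_smul] at h2
    exact h2
  have hall := fun j : Fin m ↦ (κ.unitTwist (-1)).oneCocycleClass_coord_mem_of_last_mem hm (k + 1)
    ((κ.unitTwist (-1)).eisensteinTwistChar hm (k + 1)) ((W.baseChange K).torsionGaloisModule (((3 : ℕ) : ℤ) ^ (k + 1)))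
    (fun σ y ↦ (κ.unitTwist (-1)).eisensteinTwist_torsionGaloisModule_apply hm (k + 1) (W.baseChange K) _ σ y) κ
    (fun b ↦ (W.baseChange K).geomTorsion_pow_nsmul_eq_zero 3 (k + 1) b)
    (fun _ hσ ↦ κ.eisensteinTwistChar_unitTwist_eq_one_of_mem_kerSubgroup hm (k + 1) (-1) hσ)
    (κ.eisensteinTwistChar_unitTwist_neg_one_mul_onePlusT hm (k + 1) hγ) ξ φ hφ _ h𝒮M hlastmem j
  -- (3) hence in the local condition at `v`, hence coboundaries modulo `C_v` on `ker κ ⊓ D_v`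
  have hloc : ∀ j : Fin m, resH1Hom (ContinuousMonoidHom.id κ.kerSubgroup)
      (AddSubgroup.inclusion (AcSigned.geomTorsion_zpow_le_geomPrimaryTorsion (W.baseChange K) 3 (k + 1))) (fun _ _ ↦ rfl)
      (oneCocycleClass _ (φ j)) ∈ (W.baseChange K).localKerOver 3 κ.kerSubgroup (v.adicCompletion K) := by
    intro j
    have h0 : resH1Hom (ContinuousMonoidHom.id κ.kerSubgroup)
        (AddSubgroup.inclusion (AcSigned.geomTorsion_zpow_le_geomPrimaryTorsion (W.baseChange K) 3 (k + 1)))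
        (fun _ _ ↦ rfl) (oneCocycleClass _ (φ j)) ∈ (W.baseChange K).selmerGroupOver 3 κ.kerSubgroup :=
      AddSubgroup.mem_comap.1 (hall j)
    have h1 := (((W.baseChange K).mem_selmerGroupOver_iff 3 κ.kerSubgroup _).1 h0).1 v 1
    rwa [(W.baseChange K).conjH1_one_holds 3 κ.kerSubgroup, AddMonoidHom.id_apply] at h1
  have hq : ∀ j : Fin m, ∃ q : ((W.baseChange K).kernelOfReductionLocalDatum 3 v).Gr, ∀ y : decompIn κ.kerSubgroup v,
      ((W.baseChange K).kernelOfReductionLocalDatum 3 v).grMk (AddSubgroup.inclusion (AcSigned.geomTorsion_zpow_le_geomPrimaryTorsion (W.baseChange K) 3 (k + 1))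
        ((φ j).1 (decompInToH κ.kerSubgroup v y))) = y • q - q := fun j ↦
    (W.baseChange K).exists_grMk_eq_coboundary_of_localKerOver_le_strictKer κ v hKS (φ j) (hloc j)
  choose q hq using hq
  -- (4) shift the `q_j` into `E[p^{k+1+d}]` (Part 1)
  have hshift := fun j ↦ hd (k + 1) (fun y ↦ (φ j).1 (decompInToH κ.kerSubgroup v y)) (q j) (hq j)
  choose qhat hqhat using hshift
  -- (5) an explicit cocycle of `incLocIter … d (loc_v c)` and its quotient modulo `Fil_v`
  have hcoc := W.exists_cocycle_incLocIter_localization κ hm π e hkill hker hπ he hπX hek v k ξ φ hφ d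
  rcases hcoc with ⟨η, hη, hηval⟩
  refine ⟨contOneCocycles.pullback (ContinuousMonoidHom.id _)
    (X := (GaloisRep.toLocal v ((κ.unitTwist (-1)).eisensteinTwist
        ((W.baseChange K).torsionGaloisModule (((3 : ℕ) : ℤ) ^ (k + d + 1))) hm (k + d + 1))).toTopRep)
    (Y := ((GaloisRep.toLocal v ((κ.unitTwist (-1)).eisensteinTwist
        ((W.baseChange K).torsionGaloisModule (((3 : ℕ) : ℤ) ^ (k + d + 1))) hm (k + d + 1))).quotient (((W.baseChange K).ordinaryFiltrationAt v (fun i ↦ (W.baseChange K).torsionGaloisModuleReduce 3 i) (fun _ _ ↦ rfl)).twistedFil (k + d + 1))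
        (((W.baseChange K).ordinaryFiltrationAt v (fun i ↦ (W.baseChange K).torsionGaloisModuleReduce 3 i) (fun _ _ ↦ rfl)).twistedFil_le_comap (κ := κ.unitTwist (-1)) hm (k + d + 1))).toTopRep)
    (TopRep.ofHom ⟨⟨(((W.baseChange K).ordinaryFiltrationAt v (fun i ↦ (W.baseChange K).torsionGaloisModuleReduce 3 i) (fun _ _ ↦ rfl)).twistedFil (k + d + 1)).mkQ.toAddMonoidHom.toIntLinearMap, continuous_of_discreteTopology⟩,
      fun g => ContinuousLinearMap.ext fun x => rfl⟩) η, ?_, ?_⟩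
  · rw [hξ] at hη
    rw [← hη]
    exact (map_oneCocycleClass _ _ _ η).symm
  have hle : k + 1 + d ≤ k + d + 1 := by omega
  let qh : Fin m → geomTorsion (W.baseChange K) (((3 : ℕ) : ℤ) ^ (k + d + 1)) := fun j ↦
    AddSubgroup.inclusion (geomTorsion_le_of_dvd (W.baseChange K) (pow_dvd_pow ((3 : ℕ) : ℤ) hle)) (qhat j)
  refine ⟨(((W.baseChange K).ordinaryFiltrationAt v (fun i ↦ (W.baseChange K).torsionGaloisModuleReduce 3 i) (fun _ _ ↦ rfl)).twistedFil (k + d + 1)).mkQ (((-1 : ℤ) ^ d) • ∑ i : Fin m, Twisted.tmul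
      (Ideal.Quotient.mk _ ((PowerSeries.X : IwasawaAlgebra 3) ^ (i : ℕ)) : EisensteinCoeff 3 m (k + d + 1)) (qh i)),
    fun σ hσ ↦ ?_⟩
  let y : decompIn κ.kerSubgroup v :=
    ⟨⟨absGaloisRestrict K (v.adicCompletion K) σ, (mem_decomp_iff v _).2 ⟨σ, rfl⟩⟩,
      (mem_decompIn_iff κ.kerSubgroup v _).2 hσ⟩
  have hyH : decompInToH κ.kerSubgroup v y = ⟨absGaloisRestrict K (v.adicCompletion K) σ, hσ⟩ := rfl
  have htw : ∀ (c' : EisensteinCoeff 3 m (k + d + 1)) (a : geomTorsion (W.baseChange K) (((3 : ℕ) : ℤ) ^ (k + d + 1))),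
      GaloisRep.toLocal v ((κ.unitTwist (-1)).eisensteinTwist ((W.baseChange K).torsionGaloisModule (((3 : ℕ) : ℤ) ^ (k + d + 1))) hm
        (k + d + 1)) σ (Twisted.tmul c' a) = Twisted.tmul c' (absGaloisRestrict K (v.adicCompletion K) σ • a) := by
    intro c' a
    rw [GaloisRep.toLocal_apply, ZpExtension.eisensteinTwist_apply_eq_smul_mapEnd,
      κ.eisensteinTwistChar_unitTwist_eq_one_of_mem_kerSubgroup hm (k + d + 1) (-1) hσ, one_smul,
      CoeffExtension.mapEnd_tmul]
    rfl
  -- each coordinate difference lies in `Fil_v E[p^{k+d+1}]`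
  have hfil : ∀ j : Fin m,
      AddSubgroup.inclusion (geomTorsion_le_of_dvd (W.baseChange K) (pow_dvd_pow ((3 : ℕ) : ℤ) (Nat.add_le_add_right (Nat.le_add_right k d) 1)))
          ((φ j).1 ⟨absGaloisRestrict K (v.adicCompletion K) σ, hσ⟩) -
        (absGaloisRestrict K (v.adicCompletion K) σ • qh j - qh j) ∈ ((W.baseChange K).ordinaryFiltrationAt v (fun i ↦ (W.baseChange K).torsionGaloisModuleReduce 3 i) (fun _ _ ↦ rfl)).fil (k + d + 1) := by
    intro j
    have h1 := hqhat j y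
    rw [hyH, mem_kernelOfReductionLocalDatum_plus_iff] at h1
    rw [ordinaryFiltrationAt_fil, mem_torsionFilAt_iff]
    exact h1
  -- conclude: `η σ - (σ w₀ - w₀) ∈ Fil_v W_{k+d+1}`
  rw [contOneCocycles.pullback_apply]
  change (((W.baseChange K).ordinaryFiltrationAt v (fun i ↦ (W.baseChange K).torsionGaloisModuleReduce 3 i)
      (fun _ _ ↦ rfl)).twistedFil (k + d + 1)).mkQ
      (η.1 σ : Twisted 3 m (k + d + 1) (geomTorsion (W.baseChange K) (((3 : ℕ) : ℤ) ^ (k + d + 1)))) =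
    (((W.baseChange K).ordinaryFiltrationAt v (fun i ↦ (W.baseChange K).torsionGaloisModuleReduce 3 i)
      (fun _ _ ↦ rfl)).twistedFil (k + d + 1)).mkQ (GaloisRep.toLocal v ((κ.unitTwist (-1)).eisensteinTwist
      ((W.baseChange K).torsionGaloisModule (((3 : ℕ) : ℤ) ^ (k + d + 1))) hm (k + d + 1)) σ _) -
      (((W.baseChange K).ordinaryFiltrationAt v (fun i ↦ (W.baseChange K).torsionGaloisModuleReduce 3 i)
        (fun _ _ ↦ rfl)).twistedFil (k + d + 1)).mkQ _
  rw [← map_sub, ← sub_eq_zero, ← map_sub, Submodule.mkQ_apply, Submodule.Quotient.mk_eq_zero, hηval σ hσ, map_zsmul,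
    map_sum]
  simp_rw [htw]
  rw [← smul_sub, ← smul_sub, ← Finset.sum_sub_distrib, ← Finset.sum_sub_distrib]
  simp_rw [← Twisted.tmul_sub]
  exact Submodule.smul_mem _ _ (Submodule.sum_mem _ fun j _ ↦
    ((W.baseChange K).ordinaryFiltrationAt v (fun i ↦ (W.baseChange K).torsionGaloisModuleReduce 3 i)
      (fun _ _ ↦ rfl)).tmul_mem_twistedFil (k + d + 1) _ (hfil j))

end WeierstrassCurve

end
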